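import Summits.SmoothPoincare4.SmoothPoincare4.Theorems.ConvexBisectionAcyclicBisectionExistsStubModelsOnCounts
import Literature.Topology.FourManifolds.LefschetzBasePages
import Literature.Topology.FourManifolds.RelFundamentalClassOfOrientation
import Literature.AlgebraicTopology.SingularHomology.LefschetzDualityProofs
import Literature.AlgebraicTopology.SingularHomology.UniversalCoefficientsFree
import HarnessLib

/-!
# `H₁(∂ Base g; ℤ) ≅ ℤ^{2g}` from the homology of the base (Kas' engine, input K1)
(sub-goal `stub_Kas_homologyOne_bBase` of stub `stub_modelsOn_counts`, line `modp-braid-orbits`,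
reshape r9, crux `ConvexBisection.AcyclicBisectionExists`, item stmt-SmoothPoincare4-10508)

The third clause `wordProduct (stdSymp ℤ g) l = 1` of the registered stub `stub_modelsOn_counts`
(= `LefschetzBase.modelsOn_counts_of_homotopyEquiv_sphere`, Gompf–Stipsicz 1999 §8.2) was reduced by
`…StubModelsOnCounts.lean` (`wordProduct_eq_one_of_seam`) to two inputs about the seam
`Ψ : ∂X ≅ ∂ Base g` of a one-sided model: (K1) `H₁(∂ Base g; ℤ) ≃ₗ[ℤ] ℤ^{2g}` and (K2) Kas'
presentation `H₁(∂X; ℤ) ≃ₗ[ℤ] coker(wordProduct − 1)`.  This file PROVES (K1) from the homology of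
the base — `H₂(Base g; ℤ) = H₃(Base g; ℤ) = 0` (on paper `Base g ≅ F_{g,1} × D² ≃ ⋁^{2g} S¹`; the
Betti numbers of the concrete sublevel set are computed from the Milnor cover by a companion file and
are kept here as explicit hypotheses) and a chain shadow `σ : H₁(Base g; ℤ) ≅ ℤ^{2g}`
(`IsChainShadow`, discharged by `exists_isChainShadow_holds`):

* `subsingleton_cohomology_of_isZero` — `Hₚ₊₁(W; ℤ) = 0` and `Hₚ(W; ℤ)` free `⇒ Hᵖ⁺¹(W; ℤ) = 0`
  (universal coefficients with vanishing `Ext`, tree `kroneckerPairing_bijective_of_free`);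
* `isZero_relHomology_int_of_subsingleton_cohomology` — INTEGRAL Lefschetz vanishing on an
  orientable compact 4-manifold with boundary: `Hᵖ(W; ℤ) = 0`, `p + q = 4 ⇒ H_q(W, ∂W; ℤ) = 0`
  (integral relative fundamental class of a smooth orientation,
  `NullCobordism.exists_isRelFundamentalClass_of_smoothOrientation`, and Lefschetz duality
  `bijective_relCapProduct_of_isRelFundamentalClass_holds` over `ℤ`);
* `linearEquiv_homology_boundary_of_isZero` — if `H₂(W, ∂W; ℤ) = H₁(W, ∂W; ℤ) = 0` then the
  inclusion induces `H₁(∂W; ℤ) ≅ H₁(W; ℤ)` (long exact sequence of the pair);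
* `stub_Kas_homologyOne_bBase` — the assembly for `W = Base g` (orientable as a regular sublevel
  set of `ℝ⁴`): `H₁((bBase g).carrier; ℤ) ≃ₗ[ℤ] ℤ^{2g}`.

Nothing is asserted: no named facts, no `sorry`; the homology of `Base g` enters as hypotheses.
-/

noncomputable section

-- the prescribed namespace `Summit.<P>.<Sub>.…` duplicates `SmoothPoincare4` (P = Sub)
set_option linter.dupNamespace false

open scoped Manifold ContDiff Topology
open Set Function CategoryTheory CategoryTheory.Limits
open Literature.Topology.FourManifolds Literature.Topology.FourManifolds.LefschetzBase
  Literature.AlgebraicTopology.SingularHomology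

namespace Summit.SmoothPoincare4.SmoothPoincare4.Theorems.AcyclicBisectionExists.ModpBraidOrbits

/-! ## Universal coefficients: a vanishing integral cohomology group -/

section UCT

variable {W : Type} [TopologicalSpace W]

/-- **`Hₚ₊₁(W; ℤ) = 0` and `Hₚ(W; ℤ)` free imply `Hᵖ⁺¹(W; ℤ) = 0`**: the Kronecker map
`Hᵖ⁺¹(W; ℤ) → Hom(Hₚ₊₁(W; ℤ), ℤ)` is bijective when `Hₚ(W; ℤ)` is free (Hatcher 2002, Thm. 3.2 with
`Ext(free, ℤ) = 0`; tree `kroneckerPairing_bijective_of_free`) and its target vanishes. [folklore] -/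
theorem subsingleton_cohomology_of_isZero (p : ℕ) [Module.Free ℤ (singularHomology ℤ ℤ W p)]
    (h : IsZero (singularHomology ℤ ℤ W (p + 1))) :
    Subsingleton (singularCohomology ℤ ℤ W (p + 1)) := by
  haveI : Subsingleton (singularHomology ℤ ℤ W (p + 1)) := ModuleCat.subsingleton_of_isZero h
  have hbij := kroneckerPairing_bijective_of_free ℤ W p
  exact ⟨fun a c => hbij.1 (Subsingleton.elim _ _)⟩

end UCT

/-! ## Integral Lefschetz vanishing and the first homology of the boundary -/

section Lefschetz

variable {W : Type} [TopologicalSpace W] [T2Space W] [SecondCountableTopology W] [CompactSpace W]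
  [ChartedSpace (EuclideanHalfSpace 4) W] [IsManifold (𝓡∂ 4) ∞ W]

/-- **Integral Lefschetz vanishing on an ORIENTABLE compact 4-manifold with (nonempty, abstractly
presented) boundary**: if `Hᵖ(W; ℤ) = 0` and `p + q = 4` then `H_q(W, ∂W; ℤ) = 0`.  The smooth
orientation gives an integral relative fundamental class of the null-cobordism `W` of `b.carrier`
(`NullCobordism.exists_isRelFundamentalClass_of_smoothOrientation`), and `Hᵖ(W; ℤ) → H_q(W, ∂W; ℤ)`,
`a ↦ a ⌢ [W]`, is a bijection (Hatcher Thm 3.43, tree `bijective_relCapProduct_of_isRelFundamentalClass_holds`).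
[folklore] -/
theorem isZero_relHomology_int_of_subsingleton_cohomology (b : BoundaryData (𝓡∂ 4) W (𝓡 3))
    [Nonempty b.carrier] (ho : IsOrientable (𝓡∂ 4) W) {p q : ℕ} (hpq : p + q = 4)
    (hp : Subsingleton (singularCohomology ℤ ℤ W p)) :
    IsZero (relativeSingularHomology ℤ ℤ W ((𝓡∂ 4).boundary W) q) := by
  -- adapted from `isZero_relHomology_of_isOrientable`
  -- (Summits/SmoothPoincare4/SmoothPoincare4/Theorems/ConvexBisectionAcyclicBisectionExistsStubNiceSplitting.lean)
  obtain ⟨o⟩ := ho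
  -- bridging instances at `2 + 1 + 1` / `2 + 1`
  letI i1 : ChartedSpace (EuclideanHalfSpace (2 + 1 + 1)) W := ‹ChartedSpace (EuclideanHalfSpace 4) W›
  letI i2 : IsManifold (𝓡∂ (2 + 1 + 1)) ∞ W := ‹IsManifold (𝓡∂ 4) ∞ W›
  letI i3 : ChartedSpace (EuclideanSpace ℝ (Fin (2 + 1))) b.carrier := b.chartedSpace
  letI i4 : IsManifold (𝓡 (2 + 1)) ∞ b.carrier := b.isManifold
  haveI : CompactSpace b.carrier := b.compactSpace_carrier
  -- `W` as a null-cobordism of the abstract boundary `b.carrier`, and its ℤ fundamental class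
  let c₀ : NullCobordism (2 + 1) b.carrier :=
    { W := W
      incl := b.incl
      isSmoothEmbedding_incl := b.isSmoothEmbedding
      range_incl := b.range_incl }
  obtain ⟨z, hz⟩ := c₀.exists_isRelFundamentalClass_of_smoothOrientation o
  have h : p + q = 2 + 1 + 1 := hpq
  have hbij := bijective_relCapProduct_of_isRelFundamentalClass_holds (R := ℤ) (2 + 1) W z hz h
  haveI : Subsingleton (relativeSingularHomology ℤ ℤ W ((𝓡∂ (2 + 1 + 1)).boundary W) q) :=
    ⟨fun x y => by
      obtain ⟨a, rfl⟩ := hbij.2 x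
      obtain ⟨c, rfl⟩ := hbij.2 y
      rw [Subsingleton.elim a c]⟩
  exact ModuleCat.isZero_of_subsingleton _

omit [T2Space W] [SecondCountableTopology W] [CompactSpace W] [ChartedSpace (EuclideanHalfSpace 4) W]
  [IsManifold (𝓡∂ 4) ∞ W] in
/-- **`H₂(W, A; ℤ) = H₁(W, A; ℤ) = 0` imply that the inclusion induces `H₁(A; ℤ) ≅ H₁(W; ℤ)`**
(exactness of `H₂(W, A) → H₁(A) → H₁(W) → H₁(W, A)`; a morphism of `ℤ`-modules which is mono and
epi is an isomorphism). [folklore] -/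
theorem isIso_map_subtype_of_isZero (A : Set W)
    (h2 : IsZero (relativeSingularHomology ℤ ℤ W A 2)) (h1 : IsZero (relativeSingularHomology ℤ ℤ W A 1)) :
    IsIso (singularHomology.map ℤ ℤ (⟨Subtype.val, continuous_subtype_val⟩ : C(↥A, W)) 1) := by
  have hmono : Mono (singularHomology.map ℤ ℤ (⟨Subtype.val, continuous_subtype_val⟩ : C(↥A, W)) 1) :=
    (relativeSingularHomology.exact_δ_map ℤ ℤ A 1).mono_g (h2.eq_of_src _ _)
  have hepi : Epi (singularHomology.map ℤ ℤ (⟨Subtype.val, continuous_subtype_val⟩ : C(↥A, W)) 1) :=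
    (relativeSingularHomology.exact_map_ofAbsolute ℤ ℤ A 1).epi_f (h1.eq_of_tgt _ _)
  exact isIso_of_mono_of_epi _

omit [T2Space W] [SecondCountableTopology W] [CompactSpace W] [IsManifold (𝓡∂ 4) ∞ W] in
/-- **The first homology of an abstractly presented boundary**: for boundary data `b` of `W` with
`H₂(W, ∂W; ℤ) = H₁(W, ∂W; ℤ) = 0`, `H₁(b.carrier; ℤ) ≃ₗ[ℤ] H₁(W; ℤ)` (`b.incl` is a homeomorphism
onto `∂W`, and `isIso_map_subtype_of_isZero`). [folklore] -/
theorem nonempty_linearEquiv_homology_carrier (b : BoundaryData (𝓡∂ 4) W (𝓡 3))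
    (h2 : IsZero (relativeSingularHomology ℤ ℤ W ((𝓡∂ 4).boundary W) 2))
    (h1 : IsZero (relativeSingularHomology ℤ ℤ W ((𝓡∂ 4).boundary W) 1)) :
    Nonempty (singularHomology ℤ ℤ b.carrier 1 ≃ₗ[ℤ] singularHomology ℤ ℤ W 1) := by
  -- `b.carrier ≃ₜ range b.incl = ∂W`
  let e₁ : b.carrier ≃ₜ ↥(range b.incl) := b.isSmoothEmbedding.isEmbedding.toHomeomorph
  let e₂ : ↥(range b.incl) ≃ₜ ↥((𝓡∂ 4).boundary W) := Homeomorph.setCongr b.range_incl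
  let eH : singularHomology ℤ ℤ b.carrier 1 ≃ₗ[ℤ] singularHomology ℤ ℤ ↥((𝓡∂ 4).boundary W) 1 :=
    (singularHomology.mapIso ℤ ℤ (e₁.trans e₂) 1).toLinearEquiv
  haveI := isIso_map_subtype_of_isZero ((𝓡∂ 4).boundary W) h2 h1
  let eI : singularHomology ℤ ℤ ↥((𝓡∂ 4).boundary W) 1 ≃ₗ[ℤ] singularHomology ℤ ℤ W 1 :=
    (asIso (singularHomology.map ℤ ℤ
      (⟨Subtype.val, continuous_subtype_val⟩ : C(↥((𝓡∂ 4).boundary W), W)) 1)).toLinearEquiv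
  exact ⟨eH.trans eI⟩

end Lefschetz

/-! ## The base: orientability and the assembly of K1 -/

section BaseFacts

/-- **The base is orientable** (a regular sublevel set of the oriented `ℝ⁴`; Hirsch 1976 §4.4).
[folklore] -/
theorem isOrientable_base (g : ℕ) : IsOrientable (𝓡∂ 4) (Base g) :=
  RegularSublevel.isOrientable _ (isOrientable_euclideanSpace 4)

/-- **A chain shadow makes `H₁(Base g; ℤ)` free** (it is a linear bijection onto `ℤ^{2g}`).
[folklore] -/
theorem free_homologyOne_base_of_isChainShadow {g : ℕ}
    {σ : singularHomology ℤ ℤ (Base g) 1 →ₗ[ℤ] (Fin g ⊕ Fin g → ℤ)} (hσ : IsChainShadow g σ) :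
    Module.Free ℤ (singularHomology ℤ ℤ (Base g) 1) :=
  Module.Free.of_equiv (LinearEquiv.ofBijective σ hσ.1).symm

/-- **K1, conditional form.**  If `H₁(Base g; ℤ)` admits a chain shadow (Milnor 1968 Thm 9.1,
`exists_isChainShadow_holds`) and `H₂(Base g; ℤ) = H₃(Base g; ℤ) = 0` (on paper
`Base g ≅ F_{g,1} × D² ≃ ⋁^{2g} S¹`), then `H₁(∂ Base g; ℤ) ≃ₗ[ℤ] ℤ^{2g}`: `H²(Base g; ℤ) = 0`
(`Ext(H₁, ℤ) = 0`, `Hom(H₂, ℤ) = 0`) and `H³(Base g; ℤ) = 0` (`Hom(H₃, ℤ) = 0`, `Ext(H₂, ℤ) = 0`),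
so by integral Lefschetz duality `H₂(B, ∂B; ℤ) = H₁(B, ∂B; ℤ) = 0`, the pair sequence gives
`H₁(∂B; ℤ) ≅ H₁(B; ℤ)`, and the shadow finishes.  (Gompf–Stipsicz 1999 §8.2:
`∂(F_{g,1} × D²) = #^{2g} S¹ × S²`.) [folklore] -/
theorem nonempty_linearEquiv_homologyOne_bBase (g : ℕ)
    (hσ : ∃ σ : singularHomology ℤ ℤ (Base g) 1 →ₗ[ℤ] (Fin g ⊕ Fin g → ℤ), IsChainShadow g σ)
    (h2 : IsZero (singularHomology ℤ ℤ (Base g) 2)) (h3 : IsZero (singularHomology ℤ ℤ (Base g) 3)) :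
    Nonempty (singularHomology ℤ ℤ (bBase g).carrier 1 ≃ₗ[ℤ] (Fin g ⊕ Fin g → ℤ)) := by
  obtain ⟨σ, hσ⟩ := hσ
  haveI : Nonempty (bBase g).carrier := nonempty_bBase_carrier g
  haveI := free_homologyOne_base_of_isChainShadow hσ
  -- `H²(B; ℤ) = 0` and `H³(B; ℤ) = 0`
  have hH2 : Subsingleton (singularCohomology ℤ ℤ (Base g) 2) := subsingleton_cohomology_of_isZero 1 h2
  haveI : Subsingleton (singularHomology ℤ ℤ (Base g) 2) := ModuleCat.subsingleton_of_isZero h2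
  haveI : Module.Free ℤ (singularHomology ℤ ℤ (Base g) 2) := Module.Free.of_subsingleton ℤ _
  have hH3 : Subsingleton (singularCohomology ℤ ℤ (Base g) 3) := subsingleton_cohomology_of_isZero 2 h3
  -- integral Lefschetz duality: `H₂(B, ∂B; ℤ) = H₁(B, ∂B; ℤ) = 0`
  have hrel2 : IsZero (relativeSingularHomology ℤ ℤ (Base g) ((𝓡∂ 4).boundary (Base g)) 2) :=
    isZero_relHomology_int_of_subsingleton_cohomology (bBase g) (isOrientable_base g)
      (p := 2) (q := 2) rfl hH2
  have hrel1 : IsZero (relativeSingularHomology ℤ ℤ (Base g) ((𝓡∂ 4).boundary (Base g)) 1) :=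
    isZero_relHomology_int_of_subsingleton_cohomology (bBase g) (isOrientable_base g)
      (p := 3) (q := 1) rfl hH3
  obtain ⟨e⟩ := nonempty_linearEquiv_homology_carrier (bBase g) hrel2 hrel1
  exact ⟨e.trans (LinearEquiv.ofBijective σ hσ.1)⟩

end BaseFacts

/-! ## The registered sub-goal -/

section SubGoal

/-- **Sub-goal `stub_Kas_homologyOne_bBase` of stub `stub_modelsOn_counts`** (line `modp-braid-orbits`,
r9): input (K1) of the third clause — `H₁(∂ Base g; ℤ) ≃ₗ[ℤ] ℤ^{2g}` — from a chain shadow of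
`H₁(Base g; ℤ)` (Milnor 1968, Thm 9.1) and the vanishing of `H₂(Base g; ℤ)`, `H₃(Base g; ℤ)`
(Betti numbers of `F_{g,1} × D²`), by integral Lefschetz duality and universal coefficients
(Gompf–Stipsicz 1999, §8.2: `∂(F × D²) ≅ #^{2g} S¹ × S²`). [folklore] -/
theorem stub_Kas_homologyOne_bBase :
    ∀ g : ℕ, (∃ σ : Literature.AlgebraicTopology.SingularHomology.singularHomology ℤ ℤ
        (Literature.Topology.FourManifolds.LefschetzBase.Base g) 1 →ₗ[ℤ] (Fin g ⊕ Fin g → ℤ),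
        Literature.Topology.FourManifolds.LefschetzBase.IsChainShadow g σ) →
      CategoryTheory.Limits.IsZero (Literature.AlgebraicTopology.SingularHomology.singularHomology ℤ ℤ
        (Literature.Topology.FourManifolds.LefschetzBase.Base g) 2) →
      CategoryTheory.Limits.IsZero (Literature.AlgebraicTopology.SingularHomology.singularHomology ℤ ℤ
        (Literature.Topology.FourManifolds.LefschetzBase.Base g) 3) →
      Nonempty ((Literature.AlgebraicTopology.SingularHomology.singularHomology ℤ ℤ
        (Literature.Topology.FourManifolds.LefschetzBase.bBase g).carrier 1) ≃ₗ[ℤ]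
        (Fin g ⊕ Fin g → ℤ)) :=
  fun g hσ h2 h3 => nonempty_linearEquiv_homologyOne_bBase g hσ h2 h3

end SubGoal

end Summit.SmoothPoincare4.SmoothPoincare4.Theorems.AcyclicBisectionExists.ModpBraidOrbits

end
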